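import Literature.AlgebraicGeometry.Frobenioids.BaseSectionsOfObjectsCor57Slim
import Literature.AnabelianGeometry.EtaleTheta.BiKummerOfModelCanonical
import Literature.AnabelianGeometry.EtaleTheta.BiKummerThm44SubTree
import Literature.AnabelianGeometry.EtaleTheta.Discharge.Sec3Thm37Standard

/-!
# [EtTh] Theorem 4.4: "`Ψ` preserves base-Frobenius pairs" (sub-DAG row T44-L04) DISCHARGED at the
# canonical model instance from [FrdI] Corollary 5.7 (i) — proof-only companion

S. Mochizuki, *The étale theta function …*, Publ. RIMS **45** (2009) [MochizukiEtTh2009], §4, Thm 4.4, proof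
PDF p.94 l.−2 – p.95 l.1: "Thus, `Ψ` preserves pre-steps, morphisms of Frobenius type, Frobenius degrees,
isometries, and base-Frobenius pairs [cf. [FrdI], Theorem 3.4, (ii), (iii); [FrdI], Corollary 5.7, (i),
(iv)]", used again at p.95 l.19 ("`Ψ` preserves base-Frobenius pairs of Frobenius-trivial objects").  Row
T44-L04 of `plan/L2/SUBDAG-EtTh-Thm44.md` (`Thm44Hyp.PreservesBaseFrobeniusPairs`, `BiKummerThm44Sub.lean`)
recorded this as a NAMED INPUT over the FREE field `BiKummerSetting.ArisesFromBaseFrobeniusPair`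
(Def 4.1 (iv)(e)).  At the canonical model instance `BiKummerSetting.mkOfModelCanonical` (abc-iut-L2-t9,
`BiKummerOfModelCanonical.lean`) that field IS `TemperedFrobenioid.ArisesFromBaseFrobeniusPair` — "there is a
base-Frobenius pair `(P, F)` of `C` ([FrdI] Def. 2.7 (iii), abc-iut-L1-t2's `PreFrobenioid.IsBaseFrobeniusPair`)
for which `G`, `α'` are `P`-distinguished and `α''` is `F`-distinguished" — and the row becomes a THEOREM:
abc-iut-L1's kernel-checked [FrdI] Cor. 5.7 (i) UNCONDITIONALLY over slim bases of FSM-type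
(`PreFrobenioid.cor57i_pairs_of_isSlim`, `BaseSectionsOfObjectsCor57Slim.lean`, abc-iut-w4-d086) carries
`(P₁, F₁)` to a base-Frobenius pair `(P₂, F₂)` of `C₂` into which `Ψ` maps `P₁`, with
`Ψ(F₁(n)_A) = F₂(τ n)_{Ψ A}`.  The inputs are exactly print's (p.94 l.−5/−4): "`C_i` is of standard … type
[Thm 3.7 (i), (ii)]" (abc-iut's `TemperedFrobenioid.isOfStandardType_treeCatVocab`, Thm 3.7 (ii) first clause,
PROVED modulo `hBmon`), "the base category `D_i` of `C_i` is slim [cf. Remark 3.7.2]" (named fact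
`TemperedFrobenioid.Remark372 D₀`; slimness DESCENDS to `D_i = B^temp(X_i^log)[𝒟_i]` along the fully faithful
`Base : D_i ⥤ D₀`: `isSlim_of_fullyFaithful`, twin of `isOfFSMType_of_fullyFaithful` of
`BiKummerThm44SubBase.lean`), `Φ_i` perf-factorial (Def 3.6 (i) / [FrdI] Cor 5.7 standing hypothesis).
Results:
* `isSlim_of_fullyFaithful`, `Thm44Hyp.isSlim_base₁/₂` — `D₁`, `D₂` slim ⇐ `Remark372`;
* `Thm44Hyp.cor57Hypotheses` — the standing hypotheses of [FrdI] Cor 5.7 at `(C₁, C₂, Ψ)`;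
* `Thm44Hyp.arisesFromBaseFrobeniusPair_map` — the TemperedFrobenioid-level transport (any setting);
* `Thm44Hyp.arisesFromBaseFrobeniusPair_map_treeVocab` — at the canonical vocabularies, inputs `Remark372 D₀/D₀'`,
  `hBmon₁/₂`, `Φ_i` perf-factorial ONLY;
* `Thm44Hyp.preservesBaseFrobeniusPairs_mkOfModelCanonical` — **T44-L04 `PreservesBaseFrobeniusPairs` for the
  canonical model instances**, same inputs.
HONEST FRAMING: refereed pre-IUT material ([EtTh] §4 over [FrdI] §5); no new `Prop` fact, no statement
restated; nothing here bears on [IUTchIII] Cor. 3.12; typed ≠ proved — here PROVED.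
-/

namespace Literature.AnabelianGeometry.EtaleTheta

open CategoryTheory Opposite Literature.AlgebraicGeometry.Frobenioids

namespace BiKummerSetting

universe u₀ v₀ u v w

/-! ### Slimness descends along a fully faithful functor with domain-closed essential image -/

/-- **A category fully faithfully embedded in a slim category, with essential image closed under domains of
arrows, is slim** ([FrdI] §0 p.14: `D` is slim if every forgetful functor `D_A → D` is rigid): an
automorphism `α` of `D_A → D` induces — choosing, for each arrow `Z → ι(A)` of `D₀`, an isomorph `ι(A') ≅ Z` —
an automorphism of `(D₀)_{ι A} → D₀`, which is trivial; hence so is `α` (`ι` faithful, reflects isomorphisms).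
[cite: MochizukiFrdI2008, §0 p.14] -/
theorem isSlim_of_fullyFaithful {D : Type u} [Category.{v} D] {D₀ : Type u₀} [Category.{v₀} D₀]
    (ι : D ⥤ D₀) [ι.Full] [ι.Faithful]
    (hclosed : ∀ ⦃Z : D₀⦄ ⦃A : D⦄, (Z ⟶ ι.obj A) → ∃ A' : D, Nonempty (ι.obj A' ≅ Z))
    (h₀ : IsSlim D₀) : IsSlim D := by
  refine ⟨fun A α => ?_⟩
  -- the arrows `g : Z → ι A` of `D₀` with their structure morphisms at clean types
  let gh : ∀ g : Over (ι.obj A), g.left ⟶ ι.obj A := fun g => g.hom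
  have kw : ∀ {g₁ g₂ : Over (ι.obj A)} (k : g₁ ⟶ g₂), k.left ≫ gh g₂ = gh g₁ := fun k => Over.w k
  -- chosen isomorphs `e g : ι (A' g) ≅ Z` and the lifted arrows `f g : A' g ⟶ A`
  let A' : Over (ι.obj A) → D := fun g => (hclosed (gh g)).choose
  let e : ∀ g : Over (ι.obj A), ι.obj (A' g) ≅ g.left := fun g => (hclosed (gh g)).choose_spec.some
  let f : ∀ g : Over (ι.obj A), A' g ⟶ A := fun g => ι.preimage ((e g).hom ≫ gh g)
  have hf : ∀ g : Over (ι.obj A), ι.map (f g) = (e g).hom ≫ gh g := fun g => ι.map_preimage _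
  -- the components of `α` at the lifted arrows, and their naturality
  let a : ∀ g : Over (ι.obj A), A' g ≅ A' g := fun g => α.app (Over.mk (f g))
  have ha : ∀ {g₁ g₂ : Over (ι.obj A)} (m : A' g₁ ⟶ A' g₂), m ≫ f g₂ = f g₁ →
      m ≫ (a g₂).hom = (a g₁).hom ≫ m := by
    intro g₁ g₂ m hm
    exact α.hom.naturality (Over.homMk m hm : Over.mk (f g₁) ⟶ Over.mk (f g₂))
  -- the induced automorphism of `(D₀)_{ι A} → D₀` is trivial (`D₀` slim)
  have hβ := h₀.isRigid_forget (ι.obj A) (NatIso.ofComponents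
    (fun g => (e g).symm ≪≫ ι.mapIso (a g) ≪≫ e g) (by
      intro g₁ g₂ k
      have hm : ι.preimage ((e g₁).hom ≫ k.left ≫ (e g₂).inv) ≫ f g₂ = f g₁ := by
        apply ι.map_injective
        rw [ι.map_comp, ι.map_preimage, hf, hf, Category.assoc, Category.assoc,
          (e g₂).inv_hom_id_assoc, kw]
      have hι := congrArg ι.map (ha _ hm)
      simp only [Functor.map_comp, Functor.map_preimage, Category.assoc] at hι
      show k.left ≫ (e g₂).inv ≫ ι.map (a g₂).hom ≫ (e g₂).hom =
        ((e g₁).inv ≫ ι.map (a g₁).hom ≫ (e g₁).hom) ≫ k.left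
      calc k.left ≫ (e g₂).inv ≫ ι.map (a g₂).hom ≫ (e g₂).hom
          = (e g₁).inv ≫ ((e g₁).hom ≫ k.left ≫ (e g₂).inv ≫ ι.map (a g₂).hom) ≫ (e g₂).hom := by
            simp
        _ = (e g₁).inv ≫ (ι.map (a g₁).hom ≫ (e g₁).hom ≫ k.left ≫ (e g₂).inv) ≫ (e g₂).hom := by
            rw [hι]
        _ = ((e g₁).inv ≫ ι.map (a g₁).hom ≫ (e g₁).hom) ≫ k.left := by simp))
  -- hence every lifted component of `α` is trivial (`ι` faithful)
  have h3 : ∀ g : Over (ι.obj A), (a g).hom = 𝟙 (A' g) := by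
    intro g
    have h2 := congrArg (fun γ : Over.forget (ι.obj A) ≅ Over.forget (ι.obj A) => γ.hom.app g) hβ
    simp only [NatIso.ofComponents_hom_app, Iso.trans_hom, Iso.symm_hom, Functor.mapIso_hom,
      Iso.refl_hom, NatTrans.id_app] at h2
    have h1 : ι.map (a g).hom = 𝟙 _ := by
      have h2' := congrArg (fun t => (e g).hom ≫ t ≫ (e g).inv) h2
      simpa using h2'
    exact ι.map_injective (by rw [h1, ι.map_id])
  -- and so is every component, comparing along the lift of `e g : ι (A' g) ≅ ι X`
  ext X
  rw [Iso.refl_hom, NatTrans.id_app]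
  let Xh : X.left ⟶ A := X.hom
  let k₀ : A' (Over.mk (ι.map Xh)) ≅ X.left := ι.preimageIso (e (Over.mk (ι.map Xh)))
  have hk₀ : ι.map k₀.hom = (e (Over.mk (ι.map Xh))).hom := ι.map_preimage _
  have hk : k₀.hom ≫ Xh = f (Over.mk (ι.map Xh)) :=
    ι.map_injective (by rw [ι.map_comp, hk₀, hf]; rfl)
  have hn : k₀.hom ≫ α.hom.app X = (a (Over.mk (ι.map Xh))).hom ≫ k₀.hom :=
    α.hom.naturality (Over.homMk k₀.hom hk : Over.mk (f (Over.mk (ι.map Xh))) ⟶ X)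
  rw [h3, Category.id_comp] at hn
  exact (cancel_epi k₀.hom).1 (hn.trans (Category.comp_id k₀.hom).symm)

variable {K : Type u₀} [Field K] {K' : Type u₀} [Field K'] {D₀ : Type u₀} [Category.{v₀} D₀]
  {V : FrdIMonoidStub.{w}}
  {X₁ : SemiGraphs.TemperedArithmeticGroup.{u₀} K} {X₂ : SemiGraphs.TemperedArithmeticGroup.{u₀} K'}
  {D₀' : Type u₀} [Category.{v₀} D₀']
  {T₁ : RealifiedDivisorMonoids (D₀ := D₀) V} {T₂ : RealifiedDivisorMonoids (D₀ := D₀') V}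
  {D₁ D₂ : Type u} [Category.{v} D₁] [Category.{v} D₂] {VD₁ : FrdICatStub.{u, v, w} D₁}
  {VD₂ : FrdICatStub.{u, v, w} D₂} {S₁ : BiKummerSetting X₁ T₁ D₁ VD₁} {S₂ : BiKummerSetting X₂ T₂ D₂ VD₂}

/-- **`D₁ = B^temp(X₁^log)[𝒟₁]` is slim when `D₀ = B^temp(X₁^log)` is** (Rmk 3.7.2; proof of Thm 4.4, p.94
l.−4: "the base category `D_i` of `C_i` is slim"), through `Thm44Hyp.baseShape₁`.
[cite: MochizukiEtTh2009, Rmk 3.7.2 p.80] -/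
theorem Thm44Hyp.isSlim_base₁ (h : Thm44Hyp S₁ S₂) (h₀ : IsSlim D₀) : IsSlim D₁ := by
  obtain ⟨hfull, hfaith, 𝒟, h𝒟⟩ := h.baseShape₁
  refine isSlim_of_fullyFaithful S₁.tf.base (fun Z A g => ?_) h₀
  have hA : Nonempty (S₁.tf.base.obj A ⟶ 𝒟) := (h𝒟 _).1 ⟨A, ⟨Iso.refl _⟩⟩
  exact (h𝒟 Z).2 ⟨g ≫ hA.some⟩

/-- **`D₂ = B^temp(X₂^log)[𝒟₂]` is slim when `D₀' = B^temp(X₂^log)` is** (Rmk 3.7.2), through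
`Thm44Hyp.baseShape₂`. [cite: MochizukiEtTh2009, Rmk 3.7.2 p.80] -/
theorem Thm44Hyp.isSlim_base₂ (h : Thm44Hyp S₁ S₂) (h₀ : IsSlim D₀') : IsSlim D₂ := by
  obtain ⟨hfull, hfaith, 𝒟, h𝒟⟩ := h.baseShape₂
  refine isSlim_of_fullyFaithful S₂.tf.base (fun Z A g => ?_) h₀
  have hA : Nonempty (S₂.tf.base.obj A ⟶ 𝒟) := (h𝒟 _).1 ⟨A, ⟨Iso.refl _⟩⟩
  exact (h𝒟 Z).2 ⟨g ≫ hA.some⟩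

/-! ### The standing hypotheses of [FrdI] Cor 5.7 at `(C₁, C₂, Ψ)` -/

/-- The standing hypotheses of [FrdI] Cor 5.7 (`PreFrobenioid.Cor57Hypotheses`: `C_i` Frobenioids, `Φ_i`
perf-factorial, `D_i` Div-slim, `C_i` of standard type, and — only "if `C₁, C₂` are of group-like type" —
preservation of base-isomorphisms) hold at `(C₁, C₂, Ψ)`: Div-slim ⇐ slim ([FrdI] Def 4.5 (iv)), and the
group-like clauses are vacuous since a tempered Frobenioid is NOT of group-like type (Thm 3.7 (i),
`thm37_i_treeClauses_of_isFrobenioid`). [cite: MochizukiEtTh2009, Thm 4.4 p.94] -/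
theorem Thm44Hyp.cor57Hypotheses (h : Thm44Hyp S₁ S₂)
    (hF₁ : PreFrobenioid.IsFrobenioid S₁.F) (hF₂ : PreFrobenioid.IsFrobenioid S₂.F)
    (hpf₁ : ∀ A : D₁ᵒᵖ, IsPerfFactorial (S₁.tf.Φ.carrier A))
    (hpf₂ : ∀ A : D₂ᵒᵖ, IsPerfFactorial (S₂.tf.Φ.carrier A))
    (hs₁ : IsSlim D₁) (hs₂ : IsSlim D₂)
    (hst₁ : (PreFrobenioidData.ofFunctor S₁.tf.divisorMonoid S₁.F).IsOfStandardType)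
    (hst₂ : (PreFrobenioidData.ofFunctor S₂.tf.divisorMonoid S₂.F).IsOfStandardType) :
    PreFrobenioid.Cor57Hypotheses S₁.F S₂.F h.Ψ where
  isFrobenioid₁ := hF₁
  isFrobenioid₂ := hF₂
  perfFactorial₁ := fun A => hpf₁ (op A)
  perfFactorial₂ := fun A => hpf₂ (op A)
  divSlim₁ := PreFrobenioidData.isDivSlim_of_isSlim _ hs₁
  divSlim₂ := PreFrobenioidData.isDivSlim_of_isSlim _ hs₂
  standard₁ := hst₁
  standard₂ := hst₂
  baseIso_functor := fun g₁ _ =>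
    absurd g₁ (TemperedFrobenioid.thm37_i_treeClauses_of_isFrobenioid S₁.tf hF₁).2.2
  baseIso_inverse := fun g₁ _ =>
    absurd g₁ (TemperedFrobenioid.thm37_i_treeClauses_of_isFrobenioid S₁.tf hF₁).2.2

/-! ### T44-L04 at the tempered-Frobenioid reading of Def 4.1 (iv)(e) -/

/-- **"`Ψ` preserves base-Frobenius pairs" ([FrdI] Cor 5.7 (i) at `Ψ`), in the reading of Def 4.1 (iv)(e)
by `TemperedFrobenioid.ArisesFromBaseFrobeniusPair`**: if `G ⊆ Aut_{C₁}(A)`, `α'' : A → A`, `α' : A → B`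
arise from a base-Frobenius pair `(P₁, F₁)` of `C₁`, then `Ψ(G)`, `Ψ(α'')`, `Ψ(α')` arise from a
base-Frobenius pair of `C₂` — namely the pair `(P₂, F₂)` that abc-iut-L1's [FrdI] Cor 5.7 (i)
(`PreFrobenioid.cor57i_pairs_of_isSlim`, slim bases of FSM-type) associates to `(P₁, F₁)`: `Ψ` maps `P₁` into
`P₂` and `Ψ(F₁(n)_A) = F₂(τ n)_{Ψ A}`.  Inputs: `C_i` Frobenioids, `D_i` slim and of FSM-type, the Cor 5.7
standing hypotheses. [cite: MochizukiEtTh2009, Thm 4.4 p.95] -/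
theorem Thm44Hyp.arisesFromBaseFrobeniusPair_map (h : Thm44Hyp S₁ S₂)
    (hD₁ : IsOfFSMType D₁) (hD₂ : IsOfFSMType D₂) (hs₁ : IsSlim D₁) (hs₂ : IsSlim D₂)
    (hyp : PreFrobenioid.Cor57Hypotheses S₁.F S₂.F h.Ψ)
    {A B : S₁.C} {G : Subgroup (Aut A)} {α₂ : A ⟶ A} {α₁ : A ⟶ B}
    (hG : S₁.tf.ArisesFromBaseFrobeniusPair G α₂ α₁) :
    S₂.tf.ArisesFromBaseFrobeniusPair (G.map (h.Ψ.functor.mapAut A)) (h.Ψ.functor.map α₂)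
      (h.Ψ.functor.map α₁) := by
  obtain ⟨P₁, Fr₁, hPF, hGP, hα₁, ⟨hA, n, hα₂⟩⟩ := hG
  obtain ⟨P₂, Fr₂, τ, hinto, hPF₂, hFr⟩ :=
    PreFrobenioid.cor57i_pairs_of_isSlim S₁.F S₂.F h.Ψ hD₁ hD₂ hs₁ hs₂ hyp P₁ Fr₁ hPF
  refine ⟨P₂, Fr₂, hPF₂, ?_, hinto.2 α₁ hα₁, ⟨hinto.1 A hA, τ n, ?_⟩⟩
  · intro γ hγ
    obtain ⟨γ₁, hγ₁, rfl⟩ := Subgroup.mem_map.1 hγ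
    exact hinto.2 γ₁.hom (hGP γ₁ hγ₁)
  · subst hα₂
    exact (hFr n A hA).symm

/-- The same with the Cor 5.7 standing hypotheses assembled (`cor57Hypotheses`): inputs `C_i` Frobenioids,
`Φ_i` perf-factorial, `D_i` slim and of FSM-type, `C_i` of standard type ([EtTh] Thm 3.7 (ii)).
[cite: MochizukiEtTh2009, Thm 4.4 p.95] -/
theorem Thm44Hyp.arisesFromBaseFrobeniusPair_map_of_inputs (h : Thm44Hyp S₁ S₂)
    (hF₁ : PreFrobenioid.IsFrobenioid S₁.F) (hF₂ : PreFrobenioid.IsFrobenioid S₂.F)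
    (hpf₁ : ∀ A : D₁ᵒᵖ, IsPerfFactorial (S₁.tf.Φ.carrier A))
    (hpf₂ : ∀ A : D₂ᵒᵖ, IsPerfFactorial (S₂.tf.Φ.carrier A))
    (hD₁ : IsOfFSMType D₁) (hD₂ : IsOfFSMType D₂) (hs₁ : IsSlim D₁) (hs₂ : IsSlim D₂)
    (hst₁ : (PreFrobenioidData.ofFunctor S₁.tf.divisorMonoid S₁.F).IsOfStandardType)
    (hst₂ : (PreFrobenioidData.ofFunctor S₂.tf.divisorMonoid S₂.F).IsOfStandardType)
    {A B : S₁.C} {G : Subgroup (Aut A)} {α₂ : A ⟶ A} {α₁ : A ⟶ B}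
    (hG : S₁.tf.ArisesFromBaseFrobeniusPair G α₂ α₁) :
    S₂.tf.ArisesFromBaseFrobeniusPair (G.map (h.Ψ.functor.mapAut A)) (h.Ψ.functor.map α₂)
      (h.Ψ.functor.map α₁) :=
  h.arisesFromBaseFrobeniusPair_map hD₁ hD₂ hs₁ hs₂ (h.cor57Hypotheses hF₁ hF₂ hpf₁ hpf₂ hs₁ hs₂ hst₁ hst₂) hG

/-- **T44-L04 for any pair of settings whose Def 4.1 (iv)(e) field is read by
`TemperedFrobenioid.ArisesFromBaseFrobeniusPair`** (as for `mkOfModelCanonical`): `Ψ` preserves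
base-Frobenius pairs. [cite: MochizukiEtTh2009, Thm 4.4 p.95] -/
theorem Thm44Hyp.preservesBaseFrobeniusPairs_of_inputs (h : Thm44Hyp S₁ S₂)
    (hS₁ : ∀ {A B : S₁.C} (G : Subgroup (Aut A)) (α₂ : A ⟶ A) (α₁ : A ⟶ B),
      S₁.ArisesFromBaseFrobeniusPair G α₂ α₁ → S₁.tf.ArisesFromBaseFrobeniusPair G α₂ α₁)
    (hS₂ : ∀ {A B : S₂.C} (G : Subgroup (Aut A)) (α₂ : A ⟶ A) (α₁ : A ⟶ B),
      S₂.tf.ArisesFromBaseFrobeniusPair G α₂ α₁ → S₂.ArisesFromBaseFrobeniusPair G α₂ α₁)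
    (hF₁ : PreFrobenioid.IsFrobenioid S₁.F) (hF₂ : PreFrobenioid.IsFrobenioid S₂.F)
    (hpf₁ : ∀ A : D₁ᵒᵖ, IsPerfFactorial (S₁.tf.Φ.carrier A))
    (hpf₂ : ∀ A : D₂ᵒᵖ, IsPerfFactorial (S₂.tf.Φ.carrier A))
    (hD₁ : IsOfFSMType D₁) (hD₂ : IsOfFSMType D₂) (hs₁ : IsSlim D₁) (hs₂ : IsSlim D₂)
    (hst₁ : (PreFrobenioidData.ofFunctor S₁.tf.divisorMonoid S₁.F).IsOfStandardType)
    (hst₂ : (PreFrobenioidData.ofFunctor S₂.tf.divisorMonoid S₂.F).IsOfStandardType) :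
    h.PreservesBaseFrobeniusPairs :=
  fun _ _ G α₂ α₁ hG => hS₂ _ _ _
    (h.arisesFromBaseFrobeniusPair_map_of_inputs hF₁ hF₂ hpf₁ hpf₂ hD₁ hD₂ hs₁ hs₂ hst₁ hst₂ (hS₁ G α₂ α₁ hG))

end BiKummerSetting

/-! ### At the canonical vocabularies: inputs `Remark372`, `hBmon`, perf-factorial only -/

namespace BiKummerSetting

universe u₀ v₀ u v w

variable {K : Type u₀} [Field K] {K' : Type u₀} [Field K'] {D₀ : Type u₀} [Category.{v₀} D₀]
  {X₁ : SemiGraphs.TemperedArithmeticGroup.{u₀} K} {X₂ : SemiGraphs.TemperedArithmeticGroup.{u₀} K'}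
  {D₀' : Type u₀} [Category.{v₀} D₀']
  {T₁ : RealifiedDivisorMonoids (D₀ := D₀) treeMonoidVocab.{w}}
  {T₂ : RealifiedDivisorMonoids (D₀ := D₀') treeMonoidVocab.{w}}
  {D₁ D₂ : Type u} [Category.{v} D₁] [Category.{v} D₂]
  {IsRational₁ IsStrictlyRational₁ : (D₁ᵒᵖ ⥤ CommMonCat.{w}) → Prop}
  {IsRational₂ IsStrictlyRational₂ : (D₂ᵒᵖ ⥤ CommMonCat.{w}) → Prop}

section TreeVocab

variable {S₁ : BiKummerSetting X₁ T₁ D₁ (treeCatVocab D₁ IsRational₁ IsStrictlyRational₁)}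
  {S₂ : BiKummerSetting X₂ T₂ D₂ (treeCatVocab D₂ IsRational₂ IsStrictlyRational₂)}

/-- **"`C₁` is of standard type"** ([EtTh] Thm 3.7 (ii), first clause — abc-iut's
`TemperedFrobenioid.isOfStandardType_treeCatVocab`, [FrdI] Thm 5.2 (iii)) at the canonical vocabularies, from
`hBmon₁` (`B` a monoid on `D₁`), `Remark372 D₀` (`D₁` of FSM- hence FSMFF-type) and the Thm 4.4 hypothesis
"`Φ₁` non-dilating" (`Thm44Hyp.isNonDilating₁`). [cite: MochizukiEtTh2009, Thm 3.7 (ii) p.79] -/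
theorem Thm44Hyp.isOfStandardType₁ (h : Thm44Hyp S₁ S₂) (h372 : TemperedFrobenioid.Remark372 D₀)
    (hBmon₁ : IsMonoidOn S₁.tf.ratFnFunctor) :
    (PreFrobenioidData.ofFunctor S₁.tf.divisorMonoid S₁.F).IsOfStandardType :=
  S₁.tf.isOfStandardType_treeCatVocab hBmon₁ (h.isOfFSMType_base₁ h372.2.1).isOfFSMFFType
    ((S₁.tf.isNonDilatingOn_iff_pull).mpr h.isNonDilating₁)

/-- **"`C₂` is of standard type"** at the canonical vocabularies, likewise.
[cite: MochizukiEtTh2009, Thm 3.7 (ii) p.79] -/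
theorem Thm44Hyp.isOfStandardType₂ (h : Thm44Hyp S₁ S₂) (h372' : TemperedFrobenioid.Remark372 D₀')
    (hBmon₂ : IsMonoidOn S₂.tf.ratFnFunctor) :
    (PreFrobenioidData.ofFunctor S₂.tf.divisorMonoid S₂.F).IsOfStandardType :=
  S₂.tf.isOfStandardType_treeCatVocab hBmon₂ (h.isOfFSMType_base₂ h372'.2.1).isOfFSMFFType
    ((S₂.tf.isNonDilatingOn_iff_pull).mpr h.isNonDilating₂)

/-- **"`Ψ` preserves base-Frobenius pairs" at the canonical vocabularies** (TemperedFrobenioid-level reading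
of Def 4.1 (iv)(e)), inputs `Remark372 D₀ / D₀'` (Rmk 3.7.2), `hBmon₁ / hBmon₂` ([FrdI] Thm 5.2 preamble) and
"`Φ_i` perf-factorial" ONLY: "`C_i` Frobenioid" is abc-iut's `isFrobenioid_treeCatVocab_of_isMonoidOn`, "of
standard type" is `isOfStandardType₁/₂`, "`D_i` slim / of FSM-type" are `isSlim_base_i` / `isOfFSMType_base_i`.
[cite: MochizukiEtTh2009, Thm 4.4 p.95] -/
theorem Thm44Hyp.arisesFromBaseFrobeniusPair_map_treeVocab (h : Thm44Hyp S₁ S₂)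
    (h372 : TemperedFrobenioid.Remark372 D₀) (h372' : TemperedFrobenioid.Remark372 D₀')
    (hBmon₁ : IsMonoidOn S₁.tf.ratFnFunctor) (hBmon₂ : IsMonoidOn S₂.tf.ratFnFunctor)
    (hpf₁ : ∀ A : D₁ᵒᵖ, IsPerfFactorial (S₁.tf.Φ.carrier A))
    (hpf₂ : ∀ A : D₂ᵒᵖ, IsPerfFactorial (S₂.tf.Φ.carrier A))
    {A B : S₁.C} {G : Subgroup (Aut A)} {α₂ : A ⟶ A} {α₁ : A ⟶ B}
    (hG : S₁.tf.ArisesFromBaseFrobeniusPair G α₂ α₁) :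
    S₂.tf.ArisesFromBaseFrobeniusPair (G.map (h.Ψ.functor.mapAut A)) (h.Ψ.functor.map α₂)
      (h.Ψ.functor.map α₁) :=
  h.arisesFromBaseFrobeniusPair_map_of_inputs (S₁.tf.isFrobenioid_treeCatVocab_of_isMonoidOn hBmon₁)
    (S₂.tf.isFrobenioid_treeCatVocab_of_isMonoidOn hBmon₂) hpf₁ hpf₂ (h.isOfFSMType_base₁ h372.2.1)
    (h.isOfFSMType_base₂ h372'.2.1) (h.isSlim_base₁ h372.1) (h.isSlim_base₂ h372'.1)
    (h.isOfStandardType₁ h372 hBmon₁) (h.isOfStandardType₂ h372' hBmon₂) hG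

end TreeVocab

/-! ### T44-L04 for the canonical model instances `mkOfModelCanonical` -/

section Model

variable (tf₁ : TemperedFrobenioid T₁ D₁ (treeCatVocab D₁ IsRational₁ IsStrictlyRational₁))
  (hZ₁ : tf₁.monoidType = MonoidType.Z) (hP₁ : ∀ A : D₁ᵒᵖ, IsPerfect (tf₁.Φ.carrier A))
  (IG₁ : D₁ → Prop) (gS₁ : ∀ A : D₁, IG₁ A → (X₁.Pi →* Aut A))
  (gSs₁ : ∀ (A : D₁) (hA : IG₁ A), Function.Surjective (gS₁ A hA))
  (NH₁ : Subgroup (Field.absoluteGaloisGroup K) → tf₁.category → ℕ+ → Prop) (A₀₁ : tf₁.category)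
  (hA₀₁ : PreFrobenioid.IsFrobeniusTrivial tf₁.toElem A₀₁) (hA₀₁' : IG₁ A₀₁.base)
  (tf₂ : TemperedFrobenioid T₂ D₂ (treeCatVocab D₂ IsRational₂ IsStrictlyRational₂))
  (hZ₂ : tf₂.monoidType = MonoidType.Z) (hP₂ : ∀ A : D₂ᵒᵖ, IsPerfect (tf₂.Φ.carrier A))
  (IG₂ : D₂ → Prop) (gS₂ : ∀ A : D₂, IG₂ A → (X₂.Pi →* Aut A))
  (gSs₂ : ∀ (A : D₂) (hA : IG₂ A), Function.Surjective (gS₂ A hA))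
  (NH₂ : Subgroup (Field.absoluteGaloisGroup K') → tf₂.category → ℕ+ → Prop) (A₀₂ : tf₂.category)
  (hA₀₂ : PreFrobenioid.IsFrobeniusTrivial tf₂.toElem A₀₂) (hA₀₂' : IG₂ A₀₂.base)

/-- **T44-L04 `Thm44Hyp.PreservesBaseFrobeniusPairs` DISCHARGED for the canonical model instances** of the §4
setting (`mkOfModelCanonical`: Def 4.1 (iv)(e) := `TemperedFrobenioid.ArisesFromBaseFrobeniusPair`), from
abc-iut-L1's [FrdI] Cor 5.7 (i); inputs `Remark372 D₀ / D₀'` (Rmk 3.7.2), `hBmon₁ / hBmon₂`, and "`Φ_i`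
perf-factorial" only. [cite: MochizukiEtTh2009, Thm 4.4 p.95] -/
theorem Thm44Hyp.preservesBaseFrobeniusPairs_mkOfModelCanonical
    (h : Thm44Hyp (mkOfModelCanonical X₁ tf₁ hZ₁ hP₁ IG₁ gS₁ gSs₁ NH₁ A₀₁ hA₀₁ hA₀₁')
      (mkOfModelCanonical X₂ tf₂ hZ₂ hP₂ IG₂ gS₂ gSs₂ NH₂ A₀₂ hA₀₂ hA₀₂'))
    (h372 : TemperedFrobenioid.Remark372 D₀) (h372' : TemperedFrobenioid.Remark372 D₀')
    (hBmon₁ : IsMonoidOn tf₁.ratFnFunctor) (hBmon₂ : IsMonoidOn tf₂.ratFnFunctor)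
    (hpf₁ : ∀ A : D₁ᵒᵖ, IsPerfFactorial (tf₁.Φ.carrier A))
    (hpf₂ : ∀ A : D₂ᵒᵖ, IsPerfFactorial (tf₂.Φ.carrier A)) :
    h.PreservesBaseFrobeniusPairs :=
  fun _ _ _ _ _ hG => h.arisesFromBaseFrobeniusPair_map_treeVocab h372 h372' hBmon₁ hBmon₂ hpf₁ hpf₂ hG

end Model

end BiKummerSetting

end Literature.AnabelianGeometry.EtaleTheta
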